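import Mathlib
import Summits.ResolutionOfSingularities.ResolutionOfSingularities.Theorems.PAlterationPicoverLocalModelTransversalExit
import Summits.ResolutionOfSingularities.ResolutionOfSingularities.Theorems.PAlterationPicoverLocalModelWoundExit
import Literature.AlgebraicGeometry.Resolution.RegularLocalRingsProofs
import Literature.AlgebraicGeometry.Resolution.RegularLocalRingsNormal
import Literature.AlgebraicGeometry.Resolution.AdicCompletionRegular
import HarnessLib

set_option linter.dupNamespace false -- mandated namespace of this single-conjunct summit

/-!
# A good representative forces regularity of the degree-`p` cover

Crux `Picover` (stmt-ResolutionOfSingularities-0554), line `degree-p-tower`, stub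
`isRegularRing_of_exists_good_representative`.

Let `(R, 𝔪)` be a regular local ring of prime characteristic `p` and `S ⊇ R` a normal domain,
finite over `R` of generic rank `p`.  Suppose `h ∈ R` has a `p`-th root `s ∈ S` and is a *good
representative*: `h ∉ R^p + 𝔪²`, i.e. `h - c^p ∉ 𝔪²` for every `c ∈ R`.  Then `S` is regular.

Proof.
* `A := R[X]/(X^p - h)` is a regular local ring: if `h - c^p ∈ 𝔪` for some `c` this is the
  transversal exit (`h - c^p ∈ 𝔪 ∖ 𝔪²`), otherwise the wound exit of the endgame atlas of the
  local model.  Hence `A` is a normal domain, finite free of rank `p` over `R`.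
* The `R`-algebra map `φ : A → S`, `x ↦ s`, is injective: its kernel is a prime of the domain `A`
  lying over `(0) ⊆ R` (as `R ↪ S`), and `A` is integral over `R` (incomparability).
* `coker φ` is `R`-torsion: for `x ∈ S` the `p + 1` vectors `x, φ(1), φ(t), …, φ(t^{p-1})` cannot
  be `R`-linearly independent in the rank-`p` module `S`, while the last `p` are; so
  `r x ∈ φ(A)` for some `r ≠ 0`.
* Hence every `x ∈ S` is a quotient `φ(a)/r` lying in the fraction field of `φ(A) ≅ A` and is
  integral over `R ⊆ A`; as `A` is integrally closed, `x ∈ φ(A)`.  So `φ : A ≅ S`, `S` is a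
  regular local ring, hence a regular ring (Serre).
-/

namespace Summit.ResolutionOfSingularities.ResolutionOfSingularities.Theorems.Picover.GoodRepresentative

open Polynomial IsLocalRing Literature.AlgebraicGeometry.Resolution

universe u

/-- **Integrally closed subrings with torsion cokernel are everything.**  Let `φ : A → S` be an
injective `R`-algebra map from an integrally closed domain `A` to a domain `S` integral over `R`,
and suppose every `x ∈ S` satisfies `r • x ∈ φ(A)` for some `r ∈ R` that is non-zero in `S`.
Then `φ` is surjective: `x = φ(a)/r` lies in the fraction field of `A` and is integral over `A`. -/
private theorem surjective_of_isIntegrallyClosed_of_torsion {R A S : Type*} [CommRing R]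
    [CommRing A] [IsDomain A] [IsIntegrallyClosed A] [CommRing S] [IsDomain S] [Algebra R A]
    [Algebra R S] [Algebra.IsIntegral R S] (φ : A →ₐ[R] S) (hφ : Function.Injective φ)
    (htors : ∀ x : S, ∃ r : R, algebraMap R S r ≠ 0 ∧ ∃ a : A, algebraMap R S r * x = φ a) :
    Function.Surjective φ := by
  intro x
  obtain ⟨r, hr, a, hax⟩ := htors x
  let K := FractionRing A
  let L := FractionRing S
  let g : A →+* L := (algebraMap S L).comp φ.toRingHom
  have hg : Function.Injective g := (IsFractionRing.injective S L).comp hφ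
  let ψ : K →+* L := IsFractionRing.lift hg
  have hψ : ∀ b : A, ψ (algebraMap A K b) = algebraMap S L (φ b) := fun b =>
    IsFractionRing.lift_algebraMap hg b
  have hrL : algebraMap S L (algebraMap R S r) ≠ 0 := fun h0 =>
    hr (IsFractionRing.injective S L (by rw [h0, map_zero]))
  -- the candidate preimage `y = a / r` in the fraction field of `A`
  set y : K := algebraMap A K a / algebraMap A K (algebraMap R A r) with hy_def
  have hψy : ψ y = algebraMap S L x := by
    rw [hy_def, map_div₀, hψ, hψ, φ.commutes, ← hax, map_mul]
    exact mul_div_cancel_left₀ _ hrL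
  -- `y` is integral over `A`
  have hyint : IsIntegral A y := by
    obtain ⟨f, hf, hfx⟩ := Algebra.IsIntegral.isIntegral (R := R) x
    refine ⟨f.map (algebraMap R A), hf.map _, ?_⟩
    apply ψ.injective
    have h1 : (ψ.comp (algebraMap A K)).comp (algebraMap R A) =
        (algebraMap S L).comp (algebraMap R S) := by
      ext t
      simp only [RingHom.comp_apply, hψ, AlgHom.commutes]
    rw [map_zero, hom_eval₂, eval₂_map, hψy, h1, ← hom_eval₂, hfx, map_zero]
  obtain ⟨a', ha'⟩ := IsIntegrallyClosed.isIntegral_iff.mp hyint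
  refine ⟨a', IsFractionRing.injective S L ?_⟩
  rw [← hψ, ha', hψy]

/-- **A good representative forces regularity** (direction `⇐` of the forcing criterion at a
singular point).  Let `(R, 𝔪)` be a regular local ring of prime characteristic `p`, `S` a normal
domain finite over `R` of rank `p` with `R ↪ S`, and `h = s^p` (`s ∈ S ∖ R`) a representative
with `h - c^p ∉ 𝔪²` for all `c ∈ R`.  Then `S` is a regular ring: `S ≅ R[X]/(X^p - h)`, which is
regular local by the transversal/wound exits of the local model. -/
theorem isRegularRing_of_exists_good_representative : ∀ {p : ℕ} [Fact p.Prime] {R : Type u} [CommRing R] [IsRegularLocalRing R] [CharP R p] {S : Type u} [CommRing S] [IsDomain S] [Algebra R S] [Module.Finite R S] [FaithfulSMul R S] [IsIntegrallyClosed S], Module.finrank R S = p → ∀ (h : R) (s : S), s ^ p = algebraMap R S h → s ∉ (algebraMap R S).range → (∀ c : R, h - c ^ p ∉ IsLocalRing.maximalIdeal R ^ 2) → IsRegularRing S := by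
  intro p _ R _ _ _ S _ _ _ _ _ _ hrank h s hs _ hgood
  have hp : p.Prime := Fact.out
  -- Step 1: `A := R[X]/(X^p - h)` is a regular local ring (transversal or wound exit)
  have hA : IsRegularLocalRing (AdjoinRoot ((X : R[X]) ^ p - C h)) := by
    by_cases hc : ∃ c : R, h - c ^ p ∈ maximalIdeal R
    · obtain ⟨c, hc⟩ := hc
      exact PicoverLocalModel.TransversalExit.isRegularLocalRing_adjoinRoot_of_transversal p h c
        hc (hgood c)
    · push Not at hc
      exact PicoverLocalModel.WoundExit.isRegularLocalRing_adjoinRoot_of_wound p hp h hc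
  set f : R[X] := X ^ p - C h with hf_def
  have hf : f.Monic := monic_X_pow_sub_C h hp.ne_zero
  have hnat : f.natDegree = p := by rw [hf_def]; exact natDegree_X_pow_sub_C
  haveI : Module.Finite R (AdjoinRoot f) := hf.finite_adjoinRoot
  haveI : Algebra.IsIntegral R (AdjoinRoot f) := inferInstance
  haveI : IsDomain (AdjoinRoot f) := isDomain_of_isRegularLocalRing (AdjoinRoot f)
  haveI : IsIntegrallyClosed (AdjoinRoot f) := isIntegrallyClosed_of_isRegularLocalRing (AdjoinRoot f)
  -- Step 2: `φ : A → S`, `t ↦ s`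
  have hfs : aeval s f = 0 := by
    rw [hf_def, map_sub, aeval_X_pow, aeval_C, hs, sub_self]
  let φ : AdjoinRoot f →ₐ[R] S := AdjoinRoot.liftAlgHom f (Algebra.ofId R S) s
    (by rw [Algebra.toRingHom_ofId, ← aeval_def]; exact hfs)
  -- Step 3: `φ` is injective (incomparability for the integral extension `R ⊆ A`)
  have hφ : Function.Injective φ := by
    rw [← AlgHom.coe_toRingHom, RingHom.injective_iff_ker_eq_bot]
    refine Ideal.eq_bot_of_comap_eq_bot (R := R) ?_
    rw [RingHom.comap_ker, AlgHom.comp_algebraMap, ← RingHom.injective_iff_ker_eq_bot]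
    exact FaithfulSMul.algebraMap_injective R S
  -- Step 4: the cokernel of `φ` is `R`-torsion (rank count with the power basis of `A`)
  have htors : ∀ x : S, ∃ r : R, algebraMap R S r ≠ 0 ∧ ∃ a, algebraMap R S r * x = φ a := by
    intro x
    let B := (AdjoinRoot.powerBasis' hf).basis
    have hdim : (AdjoinRoot.powerBasis' hf).dim = p := by
      rw [AdjoinRoot.powerBasis'_dim, hnat]
    have hli : LinearIndependent R (φ.toLinearMap ∘ B) :=
      B.linearIndependent.map' φ.toLinearMap (LinearMap.ker_eq_bot.mpr hφ)
    have key : ¬ ∀ (c : R) (y : S), y ∈ Submodule.span R (Set.range (φ.toLinearMap ∘ B)) →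
        c • x + y = 0 → c = 0 := by
      intro H
      have h1 := (LinearIndependent.finCons' x _ hli H).fintype_card_le_finrank
      rw [Fintype.card_fin, hrank, hdim] at h1
      omega
    push Not at key
    obtain ⟨c, y, hy, hcy, hc0⟩ := key
    have hy' : y ∈ LinearMap.range φ.toLinearMap := by
      refine (Submodule.span_le.mpr ?_) hy
      rintro _ ⟨i, rfl⟩
      exact ⟨B i, rfl⟩
    obtain ⟨a, ha⟩ := hy'
    have ha' : φ a = y := ha
    refine ⟨c, fun h0 => hc0 (FaithfulSMul.algebraMap_injective R S ?_), -a, ?_⟩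
    · rw [h0, map_zero]
    · rw [map_neg, ha', ← Algebra.smul_def, eq_neg_iff_add_eq_zero]
      exact hcy
  -- Step 5: `φ` is bijective, so `S ≅ A` is regular local, hence regular
  have hsurj : Function.Surjective φ := surjective_of_isIntegrallyClosed_of_torsion φ hφ htors
  let e : AdjoinRoot f ≃ₐ[R] S := AlgEquiv.ofBijective φ ⟨hφ, hsurj⟩
  haveI : IsRegularLocalRing S := IsRegularLocalRing.of_ringEquiv e.toRingEquiv
  exact isRegularRing_of_isRegularLocalRing S

end Summit.ResolutionOfSingularities.ResolutionOfSingularities.Theorems.Picover.GoodRepresentative
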